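import Mathlib
import HarnessLib
import Summits.AtomisticToContinuum.Crystallization.Theorems.PricedLinkCensusSoftFourRingsTypeAPrep
import Summits.AtomisticToContinuum.Crystallization.Theorems.PricedLinkCensusSoftFourRingsFacetSides
import Summits.AtomisticToContinuum.Crystallization.Theorems.PricedLinkCensusSoftFourRingsFacetUnique
import Summits.AtomisticToContinuum.Crystallization.Theorems.PricedLinkCensusSoftFourRingsTypeOPrep

/-!
# Soft four-rings, endgame: the cells at a type-O vertex

Support file for `SoftFourRings` (route `PricedLinkCensus`, sub-problem `Crystallization`),
endgame step (E5) of the evidence file (§12.8).  In the hull-level setting at zero slack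
(conditional on Tammes-13), let `v` be a vertex of **type O**: bonds `w 0, …, w 3`, bonded link
pairs exactly `{w i, w j}` and `{w k, w l}`, and assume the bond `{w i, w j}` lies in no bond
triangle other than `{v, w i, w j}` (`hα`; automatic when every vertex is of type O).

* `typeO_facet_common_neighbour` : a facet `c` through `{v, w i}` avoiding `w j` produces an
  index `t ∈ {k, l}` and a point `x ∉ N[v]` bonded to `w i` and `w t`, with the facet `c'`
  through `{v, w t}` other than the bond triangle (`c' = c`, or the facet across the non-bond
  side of `c` at `v`).
-/

namespace Summit.AtomisticToContinuum.Crystallization.Theorems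

open Real RealInnerProductSpace Literature.Geometry.DiscreteGeometry

section Setting

variable {X : Finset (EuclideanSpace ℝ (Fin 3))} {B : Finset (Finset (EuclideanSpace ℝ (Fin 3)))}
  (hT : musinTarasov2012_tammes_thirteen) (hX1 : ∀ y ∈ X, ‖y‖ = 1) (hcard : X.card = 12)
  (hsepX : ∀ u ∈ X, ∀ u' ∈ X, u ≠ u' → ⟪u, u'⟫ ≤ 1 - 1 / (2 * (101 / 100 : ℝ) ^ 2))
  (hB : ∀ T ∈ B, ∃ u ∈ X, ∃ u' ∈ X, u ≠ u' ∧ 1 - (101 / 100 : ℝ) ^ 2 / 2 ≤ ⟪u, u'⟫ ∧ T = {u, u'})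
  (hBcard : B.card = 24)
  (hdeg : ∀ v ∈ X, ∃ w : Fin 4 → EuclideanSpace ℝ (Fin 3), (∀ k, w k ∈ X) ∧
    Function.Injective w ∧ (∀ k, w k ≠ v) ∧
    (∀ k, ({v, w k} : Finset (EuclideanSpace ℝ (Fin 3))) ∈ B) ∧
    ∀ y, ({v, y} : Finset (EuclideanSpace ℝ (Fin 3))) ∈ B → ∃ k, y = w k)
  {v : EuclideanSpace ℝ (Fin 3)} (hv : v ∈ X) (w : Fin 4 → EuclideanSpace ℝ (Fin 3))
  (hwX : ∀ k, w k ∈ X) (hwinj : Function.Injective w) (hwv : ∀ k, w k ≠ v)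
  (hvw : ∀ k, ({v, w k} : Finset (EuclideanSpace ℝ (Fin 3))) ∈ B)
  (hvonly : ∀ y, ({v, y} : Finset (EuclideanSpace ℝ (Fin 3))) ∈ B → ∃ k, y = w k)
  {i j k l : Fin 4} (hnd : [i, j, k, l].Nodup)
  (hNB : ∀ a b : Fin 4, a ≠ b → ({w a, w b} : Finset (EuclideanSpace ℝ (Fin 3))) ∈ B →
    ({a, b} : Finset (Fin 4)) = {i, j} ∨ ({a, b} : Finset (Fin 4)) = {k, l})
  (hα : ∀ z, ({z, w i} : Finset (EuclideanSpace ℝ (Fin 3))) ∈ B →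
    ({z, w j} : Finset (EuclideanSpace ℝ (Fin 3))) ∈ B → z = v)

include hT hX1 hcard hsepX hB hBcard hdeg hwinj hwv hvw hvonly hnd hNB hα in
open scoped Classical in
/-- **The cell lemma at a type-O vertex** (see the module docstring). -/
theorem typeO_facet_common_neighbour (c : EuclideanSpace ℝ (Fin 3)) (hcF : c ∈ facetNormals X)
    (hvc : v ∈ tightSet X c) (hic : w i ∈ tightSet X c) (hjc : w j ∉ tightSet X c) :
    ∃ t : Fin 4, (t = k ∨ t = l) ∧ ∃ x ∈ X, x ≠ v ∧ (∀ s, x ≠ w s) ∧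
      ({x, w i} : Finset (EuclideanSpace ℝ (Fin 3))) ∈ B ∧
      ({x, w t} : Finset (EuclideanSpace ℝ (Fin 3))) ∈ B ∧
      ∃ c' ∈ facetNormals X, v ∈ tightSet X c' ∧ w t ∈ tightSet X c' ∧
        (c' = c ∨ (tightSet X c = {v, w i, x} ∧ tightSet X c' = {v, x, w t})) := by
  obtain ⟨h0, hBH, -⟩ := hull_counts_of_twelve hT hX1 hcard hsepX hB hBcard
  have hnd' : (i ≠ j ∧ i ≠ k ∧ i ≠ l) ∧ (j ≠ k ∧ j ≠ l) ∧ k ≠ l := by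
    simp only [List.nodup_cons, List.mem_cons, not_or, List.not_mem_nil,
      not_false_eq_true, and_true, List.nodup_nil] at hnd
    exact hnd
  have hfour := fin_four_eq_of_nodup i j k l hnd
  have hkl_of : ∀ t, t ≠ i → t ≠ j → t = k ∨ t = l := by
    intro t hti htj
    rcases hfour t with h | h | h | h
    · exact absurd h hti
    · exact absurd h htj
    · exact Or.inl h
    · exact Or.inr h
  have kinds := facet_kinds_of_no_slack hT hX1 hcard hsepX hB hBcard hdeg
  have hvi : v ≠ w i := (hwv i).symm
  -- a bond of `w i` inside the link is `w j`
  have hlink : ∀ {x : EuclideanSpace ℝ (Fin 3)},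
      ({x, w i} : Finset (EuclideanSpace ℝ (Fin 3))) ∈ B → ∀ s, x = w s → s = j := by
    intro x hx s hs
    subst hs
    exact eq_j_of_bond_i w hnd hNB s (fun h => (ne_of_mem_bonds hB hx) (by rw [h])) hx
  rcases kinds c hcF with ⟨h3, hnb1⟩ | ⟨h4, hnb0⟩
  · ----------------------------------------------------------------- triangle `{v, w i, z}`
    obtain ⟨z, hzv, hzi, hTc⟩ := eq_three_of_two_mem h3 hvc hic hvi
    have hzc : z ∈ tightSet X c := by rw [hTc]; simp
    have hzX : z ∈ X := tightSet_subset X c hzc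
    by_cases hvz : ({v, z} : Finset (EuclideanSpace ℝ (Fin 3))) ∈ B
    · --------------------------------------------- `z = w t` is a bond of `v`: apex triangle
      obtain ⟨t, rfl⟩ := hvonly z hvz
      have hti : t ≠ i := fun h => hzi (by rw [h])
      have htj : t ≠ j := fun h => hjc (by rw [← h]; exact hzc)
      have htkl := hkl_of t hti htj
      have hit : ({w i, w t} : Finset (EuclideanSpace ℝ (Fin 3))) ∉ B :=
        not_mem_bonds_cross w hnd hNB i t (Or.inl rfl) htkl
      -- the side `{w i, w t}` and the facet across it
      have hside : ({w i, w t} : Finset (EuclideanSpace ℝ (Fin 3))) ∈ edgesOfFacet X c :=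
        pair_mem_edgesOfFacet_of_card_three hX1 h0 hcF h3 hic hzc hzi.symm
      have hH : ({w i, w t} : Finset (EuclideanSpace ℝ (Fin 3))) ∈ hullEdges X := by
        unfold edgesOfFacet at hside; exact (Finset.mem_filter.1 hside).1
      obtain ⟨c'', hc''F, hc''ne, hsub''⟩ := exists_facet_ne_of_mem_hullEdges hX1 h0 hH c
      have hi'' : w i ∈ tightSet X c'' := hsub'' (by simp)
      have ht'' : w t ∈ tightSet X c'' := hsub'' (by simp)
      have hside'' : ({w i, w t} : Finset (EuclideanSpace ℝ (Fin 3))) ∈ edgesOfFacet X c'' :=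
        pair_mem_edgesOfFacet hH hi'' ht''
      rcases kinds c'' hc''F with ⟨h3'', hnb1''⟩ | ⟨-, hnb0''⟩
      · have hnb'' : ((edgesOfFacet X c'').filter (fun T => T ∉ B)).card = 1 :=
          le_antisymm hnb1'' (one_le_nb_of_side hside'' hit)
        obtain ⟨x, hxi, hxt, hTc''⟩ := eq_three_of_two_mem h3'' hi'' ht'' hzi.symm
        obtain ⟨hBix, hBtx⟩ := mem_bonds_of_nb_one hX1 h0 hc''F hTc'' h3'' hnb'' hit
        have hxv : x ≠ v := by
          intro hxv
          apply hc''ne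
          refine (mem_facetNormals.1 hc''F).eq_of_tightSet_eq ?_
          rw [hTc'', hTc, hxv]
          exact (tri_rotl v (w i) (w t)).symm
        have hxc'' : x ∈ tightSet X c'' := by rw [hTc'']; simp
        have hBxi : ({x, w i} : Finset (EuclideanSpace ℝ (Fin 3))) ∈ B := by
          rw [Finset.pair_comm]; exact hBix
        have hBxt : ({x, w t} : Finset (EuclideanSpace ℝ (Fin 3))) ∈ B := by
          rw [Finset.pair_comm]; exact hBtx
        have hxw : ∀ s, x ≠ w s := by
          intro s hs
          have hsj := hlink hBxi s hs
          rw [hsj] at hs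
          rw [hs] at hBxt
          exact not_mem_bonds_cross w hnd hNB j t (Or.inr rfl) htkl hBxt
        exact ⟨t, htkl, x, tightSet_subset X c'' hxc'', hxv, hxw, hBxi, hBxt, c, hcF, hvc, hzc,
          Or.inl rfl⟩
      · exact absurd (mem_bonds_of_nb_zero hnb0'' hside'') hit
    · --------------------------------------------- `{v, z}` is the non-bond side of `c`
      have hside : ({v, z} : Finset (EuclideanSpace ℝ (Fin 3))) ∈ edgesOfFacet X c :=
        pair_mem_edgesOfFacet_of_card_three hX1 h0 hcF h3 hvc hzc hzv.symm
      have hnb : ((edgesOfFacet X c).filter (fun T => T ∉ B)).card = 1 :=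
        le_antisymm hnb1 (one_le_nb_of_side hside hvz)
      have hTc' : tightSet X c = {v, z, w i} := by rw [hTc, tri_swap23]
      obtain ⟨-, hBzi⟩ := mem_bonds_of_nb_one hX1 h0 hcF hTc' h3 hnb hvz
      have hzw : ∀ s, z ≠ w s := by
        intro s hs; subst hs; exact hvz (hvw s)
      have hH : ({v, z} : Finset (EuclideanSpace ℝ (Fin 3))) ∈ hullEdges X := by
        unfold edgesOfFacet at hside; exact (Finset.mem_filter.1 hside).1
      obtain ⟨c'', hc''F, hc''ne, hsub''⟩ := exists_facet_ne_of_mem_hullEdges hX1 h0 hH c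
      have hv'' : v ∈ tightSet X c'' := hsub'' (by simp)
      have hz'' : z ∈ tightSet X c'' := hsub'' (by simp)
      have hside'' : ({v, z} : Finset (EuclideanSpace ℝ (Fin 3))) ∈ edgesOfFacet X c'' :=
        pair_mem_edgesOfFacet hH hv'' hz''
      rcases kinds c'' hc''F with ⟨h3'', hnb1''⟩ | ⟨-, hnb0''⟩
      · have hnb'' : ((edgesOfFacet X c'').filter (fun T => T ∉ B)).card = 1 :=
          le_antisymm hnb1'' (one_le_nb_of_side hside'' hvz)
        obtain ⟨u, huv, huz, hTc''⟩ := eq_three_of_two_mem h3'' hv'' hz'' hzv.symm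
        obtain ⟨hBvu, hBzu⟩ := mem_bonds_of_nb_one hX1 h0 hc''F hTc'' h3'' hnb'' hvz
        obtain ⟨t, rfl⟩ := hvonly u hBvu
        have hti : t ≠ i := by
          intro hti
          apply hc''ne
          refine (mem_facetNormals.1 hc''F).eq_of_tightSet_eq ?_
          rw [hTc'', hTc, hti, tri_swap23]
        have htj : t ≠ j := by
          intro htj
          rw [htj] at hBzu
          exact hzv (hα z hBzi hBzu)
        have htkl := hkl_of t hti htj
        have ht'' : w t ∈ tightSet X c'' := by rw [hTc'']; simp
        exact ⟨t, htkl, z, hzX, hzv, hzw, hBzi, hBzu, c'', hc''F, hv'', ht'', Or.inr ⟨hTc, hTc''⟩⟩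
      · exact absurd (mem_bonds_of_nb_zero hnb0'' hside'') hvz
  · ----------------------------------------------------------------- quadrilateral
    have hS₁ : ({v, w i} : Finset (EuclideanSpace ℝ (Fin 3))) ∈ edgesOfFacet X c :=
      pair_mem_edgesOfFacet (hBH (hvw i)) hvc hic
    have hfv := card_edgesOfFacet_filter_mem hX1 h0 hcF hvc
    have hS₁f : ({v, w i} : Finset (EuclideanSpace ℝ (Fin 3))) ∈
        (edgesOfFacet X c).filter (fun T => v ∈ T) := Finset.mem_filter.2 ⟨hS₁, by simp⟩
    obtain ⟨S₂, hS₂f, hS₂ne⟩ :=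
      Finset.exists_mem_ne (by rw [hfv]; norm_num) ({v, w i} : Finset _)
    obtain ⟨hS₂, hvS₂⟩ := Finset.mem_filter.1 hS₂f
    obtain ⟨y, hyc, hyv, rfl⟩ := side_eq_pair hS₂ hvS₂
    obtain ⟨t, rfl⟩ := hvonly y (mem_bonds_of_nb_zero hnb0 hS₂)
    have hti : t ≠ i := fun h => hS₂ne (by rw [h])
    have htj : t ≠ j := fun h => hjc (by rw [← h]; exact hyc)
    have htkl := hkl_of t hti htj
    have hit : w i ≠ w t := fun h => hti (hwinj h).symm
    obtain ⟨x, hxv, hxi, hxt, hTc⟩ := eq_four_of_three_mem h4 hvc hic hyc hvi (hwv t).symm hit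
    have hxc : x ∈ tightSet X c := by rw [hTc]; simp
    -- the two sides at `x` are `{x, w i}` and `{x, w t}`
    have hfx := card_edgesOfFacet_filter_mem hX1 h0 hcF hxc
    have hxside : ∀ S ∈ (edgesOfFacet X c).filter (fun T => x ∈ T),
        S = {x, w i} ∨ S = {x, w t} := by
      intro S hS
      obtain ⟨hSE, hxS⟩ := Finset.mem_filter.1 hS
      obtain ⟨y, hyc', hyx, rfl⟩ := side_eq_pair hSE hxS
      rw [hTc] at hyc'
      simp only [Finset.mem_insert, Finset.mem_singleton] at hyc'
      rcases hyc' with hy | hy | hy | hy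
      · -- `{x, v}` would be a third side at `v`
        exfalso
        rw [hy] at hSE
        have h3v : ({({v, w i} : Finset (EuclideanSpace ℝ (Fin 3))), {v, w t}, {x, v}} :
            Finset (Finset (EuclideanSpace ℝ (Fin 3)))) ⊆
            (edgesOfFacet X c).filter (fun T => v ∈ T) := by
          intro S hS
          simp only [Finset.mem_insert, Finset.mem_singleton] at hS
          rcases hS with rfl | rfl | rfl
          · exact hS₁f
          · exact hS₂f
          · exact Finset.mem_filter.2 ⟨hSE, by simp⟩
        have hcard3 : ({({v, w i} : Finset (EuclideanSpace ℝ (Fin 3))), {v, w t}, {x, v}} :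
            Finset (Finset (EuclideanSpace ℝ (Fin 3)))).card = 3 := by
          refine Finset.card_eq_three.2 ⟨_, _, _, hS₂ne.symm, ?_, ?_, rfl⟩
          · intro h
            have : w i ∈ ({x, v} : Finset (EuclideanSpace ℝ (Fin 3))) := by rw [← h]; simp
            simp only [Finset.mem_insert, Finset.mem_singleton] at this
            rcases this with h' | h'
            · exact hxi h'.symm
            · exact hvi h'.symm
          · intro h
            have : w t ∈ ({x, v} : Finset (EuclideanSpace ℝ (Fin 3))) := by rw [← h]; simp
            simp only [Finset.mem_insert, Finset.mem_singleton] at this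
            rcases this with h' | h'
            · exact hxt h'.symm
            · exact (hwv t) h'
        have := Finset.card_le_card h3v
        rw [hcard3, hfv] at this
        omega
      · exact Or.inl (by rw [hy])
      · exact Or.inr (by rw [hy])
      · exact absurd hy hyx
    have hboth : ({x, w i} : Finset (EuclideanSpace ℝ (Fin 3))) ∈ edgesOfFacet X c ∧
        ({x, w t} : Finset (EuclideanSpace ℝ (Fin 3))) ∈ edgesOfFacet X c := by
      obtain ⟨S, hS, S', hS', hSS'⟩ : ∃ S ∈ (edgesOfFacet X c).filter (fun T => x ∈ T),
          ∃ S' ∈ (edgesOfFacet X c).filter (fun T => x ∈ T), S ≠ S' := by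
        obtain ⟨S, hS⟩ : ((edgesOfFacet X c).filter (fun T => x ∈ T)).Nonempty :=
          Finset.card_pos.1 (by rw [hfx]; norm_num)
        obtain ⟨S', hS', hne⟩ := Finset.exists_mem_ne (by rw [hfx]; norm_num) S
        exact ⟨S, hS, S', hS', hne.symm⟩
      have hSE := (Finset.mem_filter.1 hS).1
      have hS'E := (Finset.mem_filter.1 hS').1
      rcases hxside S hS with rfl | rfl <;> rcases hxside S' hS' with rfl | rfl
      · exact absurd rfl hSS'
      · exact ⟨hSE, hS'E⟩
      · exact ⟨hS'E, hSE⟩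
      · exact absurd rfl hSS'
    have hBxi : ({x, w i} : Finset (EuclideanSpace ℝ (Fin 3))) ∈ B :=
      mem_bonds_of_nb_zero hnb0 hboth.1
    have hBxt : ({x, w t} : Finset (EuclideanSpace ℝ (Fin 3))) ∈ B :=
      mem_bonds_of_nb_zero hnb0 hboth.2
    have hxw : ∀ s, x ≠ w s := by
      intro s hs
      have hsj := hlink hBxi s hs
      rw [hsj] at hs
      exact hjc (by rw [← hs]; exact hxc)
    exact ⟨t, htkl, x, tightSet_subset X c hxc, hxv, hxw, hBxi, hBxt, c, hcF, hvc, hyc, Or.inl rfl⟩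


include hT hX1 hcard hsepX hB hBcard hdeg hv hwX hwinj hwv hvw hvonly hnd hNB hα in
open scoped Classical in
/-- **Common neighbours at a type-O vertex**: the cells pair `{w i, w j}` with `{w k, w l}`
bijectively — `w i` has a common bond `x ∉ N[v]` with one of `w k, w l` and `w j` with the
other. -/
theorem typeO_common_neighbours
    (hBij : ({w i, w j} : Finset (EuclideanSpace ℝ (Fin 3))) ∈ B) (hBkl : ({w k, w l} : Finset (EuclideanSpace ℝ (Fin 3))) ∈ B) :
    ((∃ x ∈ X, x ≠ v ∧ (∀ s, x ≠ w s) ∧ ({x, w i} : Finset (EuclideanSpace ℝ (Fin 3))) ∈ B ∧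
        ({x, w k} : Finset (EuclideanSpace ℝ (Fin 3))) ∈ B) ∧
      (∃ x ∈ X, x ≠ v ∧ (∀ s, x ≠ w s) ∧ ({x, w j} : Finset (EuclideanSpace ℝ (Fin 3))) ∈ B ∧
        ({x, w l} : Finset (EuclideanSpace ℝ (Fin 3))) ∈ B)) ∨
    ((∃ x ∈ X, x ≠ v ∧ (∀ s, x ≠ w s) ∧ ({x, w i} : Finset (EuclideanSpace ℝ (Fin 3))) ∈ B ∧
        ({x, w l} : Finset (EuclideanSpace ℝ (Fin 3))) ∈ B) ∧
      (∃ x ∈ X, x ≠ v ∧ (∀ s, x ≠ w s) ∧ ({x, w j} : Finset (EuclideanSpace ℝ (Fin 3))) ∈ B ∧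
        ({x, w k} : Finset (EuclideanSpace ℝ (Fin 3))) ∈ B)) := by
  obtain ⟨h0, hBH, -⟩ := hull_counts_of_twelve hT hX1 hcard hsepX hB hBcard
  have hnd' : (i ≠ j ∧ i ≠ k ∧ i ≠ l) ∧ (j ≠ k ∧ j ≠ l) ∧ k ≠ l := by
    simp only [List.nodup_cons, List.mem_cons, not_or, List.not_mem_nil,
      not_false_eq_true, and_true, List.nodup_nil] at hnd
    exact hnd
  -- the swapped data
  have hndj : [j, i, k, l].Nodup := by
    simp only [List.nodup_cons, List.mem_cons, not_or, List.not_mem_nil,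
      not_false_eq_true, and_true, List.nodup_nil]
    exact ⟨⟨fun h => hnd'.1.1 h.symm, hnd'.2.1.1, hnd'.2.1.2⟩, ⟨hnd'.1.2.1, hnd'.1.2.2⟩, hnd'.2.2⟩
  have hNBj : ∀ a b : Fin 4, a ≠ b → ({w a, w b} : Finset (EuclideanSpace ℝ (Fin 3))) ∈ B →
      ({a, b} : Finset (Fin 4)) = {j, i} ∨ ({a, b} : Finset (Fin 4)) = {k, l} := by
    intro a b hab h
    rw [Finset.pair_comm j i]
    exact hNB a b hab h
  have hαj : ∀ z, ({z, w j} : Finset (EuclideanSpace ℝ (Fin 3))) ∈ B → ({z, w i} : Finset (EuclideanSpace ℝ (Fin 3))) ∈ B → z = v :=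
    fun z h1 h2 => hα z h2 h1
  -- the two bond triangles at `v`
  obtain ⟨c₁, hc₁F, hc₁T, -⟩ :=
    bondTriangle_at_of_mem_bonds hX1 hsepX hB hv w hwX hwinj hwv hvw hnd'.1.1 hBij
  obtain ⟨c₂, hc₂F, hc₂T, -⟩ :=
    bondTriangle_at_of_mem_bonds hX1 hsepX hB hv w hwX hwinj hwv hvw hnd'.2.2 hBkl
  -- the other facets through `{v, w i}` and `{v, w j}`
  obtain ⟨G, hGF, hGne, hGsub⟩ := exists_facet_ne_of_mem_hullEdges hX1 h0 (hBH (hvw i)) c₁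
  obtain ⟨G', hG'F, hG'ne, hG'sub⟩ := exists_facet_ne_of_mem_hullEdges hX1 h0 (hBH (hvw j)) c₁
  have hvG : v ∈ tightSet X G := hGsub (by simp)
  have hiG : w i ∈ tightSet X G := hGsub (by simp)
  have hvG' : v ∈ tightSet X G' := hG'sub (by simp)
  have hjG' : w j ∈ tightSet X G' := hG'sub (by simp)
  have hv₁ : v ∈ tightSet X c₁ := by rw [hc₁T]; simp
  have hi₁ : w i ∈ tightSet X c₁ := by rw [hc₁T]; simp
  have hj₁ : w j ∈ tightSet X c₁ := by rw [hc₁T]; simp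
  have hvi : v ≠ w i := (hwv i).symm
  have hvj : v ≠ w j := (hwv j).symm
  have hij : w i ≠ w j := fun h => hnd'.1.1 (hwinj h)
  have hjG : w j ∉ tightSet X G := fun h =>
    hGne (facetNormal_eq_of_three_common hX1 hvG hiG h hv₁ hi₁ hj₁ hvi hvj hij)
  have hiG' : w i ∉ tightSet X G' := fun h =>
    hG'ne (facetNormal_eq_of_three_common hX1 hvG' h hjG' hv₁ hi₁ hj₁ hvi hvj hij)
  obtain ⟨t₁, ht₁, x₁, hx₁X, hx₁v, hx₁w, hB₁i, hB₁t, H₁, hH₁F, hvH₁, htH₁, tag₁⟩ :=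
    typeO_facet_common_neighbour hT hX1 hcard hsepX hB hBcard hdeg w hwinj hwv hvw hvonly hnd
      hNB hα G hGF hvG hiG hjG
  obtain ⟨t₂, ht₂, x₂, hx₂X, hx₂v, hx₂w, hB₂j, hB₂t, H₂, hH₂F, hvH₂, htH₂, tag₂⟩ :=
    typeO_facet_common_neighbour hT hX1 hcard hsepX hB hBcard hdeg w hwinj hwv hvw hvonly hndj
      hNBj hαj G' hG'F hvG' hjG' hiG'
  -- the two indices differ
  have ht₁₂ : t₁ ≠ t₂ := by
    intro heq
    rw [← heq] at hB₂t htH₂ tag₂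
    have htkl : t₁ = k ∨ t₁ = l := ht₁
    have hv₂ : v ∈ tightSet X c₂ := by rw [hc₂T]; simp
    have ht₂' : w t₁ ∈ tightSet X c₂ := by
      rw [hc₂T]; rcases htkl with rfl | rfl <;> simp
    have hnot₂ : ∀ y ∈ tightSet X c₂, y = v ∨ y = w k ∨ y = w l := by
      intro y hy
      rw [hc₂T] at hy
      simp only [Finset.mem_insert, Finset.mem_singleton] at hy
      exact hy
    have hsub : ∀ c', v ∈ tightSet X c' → w t₁ ∈ tightSet X c' →
        ({v, w t₁} : Finset (EuclideanSpace ℝ (Fin 3))) ⊆ tightSet X c' := by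
      intro c' h1 h2 y hy
      rw [Finset.mem_insert, Finset.mem_singleton] at hy
      rcases hy with rfl | rfl <;> assumption
    -- `H₁, H₂ ≠ c₂`
    have hne₁ : H₁ ≠ c₂ := by
      intro h
      rcases tag₁ with e | ⟨-, hT⟩
      · have : w i ∈ tightSet X c₂ := by rw [← h, e]; exact hiG
        rcases hnot₂ _ this with h' | h' | h'
        · exact hvi h'.symm
        · exact hnd'.1.2.1 (hwinj h')
        · exact hnd'.1.2.2 (hwinj h')
      · have : x₁ ∈ tightSet X c₂ := by rw [← h, hT]; simp
        rcases hnot₂ _ this with h' | h' | h'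
        · exact hx₁v h'
        · exact hx₁w k h'
        · exact hx₁w l h'
    have hne₂ : H₂ ≠ c₂ := by
      intro h
      rcases tag₂ with e | ⟨-, hT⟩
      · have : w j ∈ tightSet X c₂ := by rw [← h, e]; exact hjG'
        rcases hnot₂ _ this with h' | h' | h'
        · exact hvj h'.symm
        · exact hnd'.2.1.1 (hwinj h')
        · exact hnd'.2.1.2 (hwinj h')
      · have : x₂ ∈ tightSet X c₂ := by rw [← h, hT]; simp
        rcases hnot₂ _ this with h' | h' | h'
        · exact hx₂v h'
        · exact hx₂w k h'
        · exact hx₂w l h'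
    have hH : H₁ = H₂ := by
      by_contra hne
      exact false_of_three_facetsOfEdge hX1 h0 (hBH (hvw t₁)) hc₂F hH₁F hH₂F (hsub c₂ hv₂ ht₂')
        (hsub H₁ hvH₁ htH₁) (hsub H₂ hvH₂ htH₂) hne₁.symm hne₂.symm hne
    have hit : w i ≠ w t₁ := by
      rcases htkl with e | e <;> rw [e]
      · exact fun h => hnd'.1.2.1 (hwinj h)
      · exact fun h => hnd'.1.2.2 (hwinj h)
    have hjt : w j ≠ w t₁ := by
      rcases htkl with e | e <;> rw [e]
      · exact fun h => hnd'.2.1.1 (hwinj h)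
      · exact fun h => hnd'.2.1.2 (hwinj h)
    rcases tag₁ with e₁ | ⟨hTG, hT₁⟩ <;> rcases tag₂ with e₂ | ⟨hTG', hT₂⟩
    · exact hjG (by rw [← e₁, hH, e₂]; exact hjG')
    · have : w i ∈ tightSet X H₂ := by rw [← hH, e₁]; exact hiG
      rw [hT₂] at this
      simp only [Finset.mem_insert, Finset.mem_singleton] at this
      rcases this with h | h | h
      · exact hvi h.symm
      · exact hx₂w i h.symm
      · exact hit h
    · have : w j ∈ tightSet X H₁ := by rw [hH, e₂]; exact hjG'
      rw [hT₁] at this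
      simp only [Finset.mem_insert, Finset.mem_singleton] at this
      rcases this with h | h | h
      · exact hvj h.symm
      · exact hx₁w j h.symm
      · exact hjt h
    · have : x₁ ∈ tightSet X H₂ := by rw [← hH, hT₁]; simp
      rw [hT₂] at this
      simp only [Finset.mem_insert, Finset.mem_singleton] at this
      rcases this with h | h | h
      · exact hx₁v h
      · rw [h] at hB₁i
        exact hx₂v (hα x₂ hB₁i hB₂j)
      · exact hx₁w t₁ h
  -- assemble
  rcases ht₁ with rfl | rfl <;> rcases ht₂ with rfl | rfl
  · exact absurd rfl ht₁₂
  · exact Or.inl ⟨⟨x₁, hx₁X, hx₁v, hx₁w, hB₁i, hB₁t⟩, ⟨x₂, hx₂X, hx₂v, hx₂w, hB₂j, hB₂t⟩⟩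
  · exact Or.inr ⟨⟨x₁, hx₁X, hx₁v, hx₁w, hB₁i, hB₁t⟩, ⟨x₂, hx₂X, hx₂v, hx₂w, hB₂j, hB₂t⟩⟩
  · exact absurd rfl ht₁₂

end Setting

end Summit.AtomisticToContinuum.Crystallization.Theorems
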